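import Literature.AlgebraicGeometry.Motives.AbelianVarietyBrauerRelationIsogenies
import HarnessLib

/-!
# DEFLATION (projection) of Brauer relations along `G → G/N` (Bartel–Dokchitser §2) and the projected Kani–Rosen
# isogeny relations: a relation `c₀·{1} + c_G·G + Σ_i c_i H_i = d₀·{1} + d_G·G + Σ_j d_j H'_j` of `G` gives, for every
# abelian variety with `G`-action and every `N ◁ G`, `B_N^{c₀} × B_G^{c_G|G|} × ∏_i B_{NH_i}^{c_i|H_i|} ∼ B_N^{d₀} × ⋯`
# — ALGEBRAIC carrier, Hom counts over an arbitrary field, isogenies over a perfect field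

Layer A1/A2 of the Hodge foundations lane (`lit-hodgefound`, row A1-20⁺ · A2, seat p03 generation 25, row g25-#7) on
the ALGEBRAIC carrier `AbelianVariety K` of `Motives/AbelianVariety`; sequel of
`Motives/AbelianVarietyBrauerRelationIsogenies` (Kani–Rosen's Theorem 3 through relations of CLASS FUNCTIONS
`c₀ f(1) + c_G Σ_G f + Σ_i c_i Σ_{H_i} f = ⋯`; CONSUMED by name: `classRelation_of_marks`,
`sum_mul_finrank_hom_image_eq_of_classRelation`) and companion of `Motives/AbelianVarietyBrauerRelationInflation`
(inflation `G/N ⇝ G`).  "**Projection (or deflation).** If `N ◁ G`, then `NΘ = Σ_i NH_i` is a `G/N`-relation" —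
and, inflated back, `Σ_i n_i NH_i` is again a `G`-relation.  At the level of class functions the projection is the
`N`-AVERAGE `f ↦ f̃`, `f̃(g) = Σ_{n ∈ N} f(ng)`: `f̃` is again a class function, `f̃(1) = Σ_N f`, `Σ_G f̃ = |N| Σ_G f`
and `Σ_{H} f̃ = |N ∩ H| · Σ_{NH} f` (the fibres of `N × H → NH` are cosets of `N ∩ H`), so a relation of class
functions for `({1}; H_i)` becomes one for `(N; NH_i)` with the same coefficients up to the factor `|N|` (§1); for an
abelian variety with `G`-action the factor `X` becomes `B_N` and `B_{H_i}` becomes `B_{NH_i}` (§2).  Everything here is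
PROVED; the file introduces NO definition and NO named fact (net Literature debt 0).

## Sources, verbatim

A. Bartel, T. Dokchitser, *Brauer relations in finite groups*, J. Eur. Math. Soc. **17** (2015) 2473–2512
(arXiv 1103.2047, held text `paper:arxiv-1103.2047`), §2 "First properties" (p0006 of the held text): "Relations can be
induced from and restricted to subgroups, and lifted from and projected to quotients as follows: let `Θ = Σ_i n_i H_i`
be a `G`-relation. • Induction. […] • Inflation. If `G ≅ G̃/N`, then each `H_i` corresponds to a subgroup `H̃_i` of
`G̃` containing `N`, and, inflating the permutation representations from a quotient, we see that `Θ̃ = Σ_i n_i H̃_i`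
is a `G̃`-relation. • Restriction. […] • Projection (or deflation). If `N ◁ G`, then `NΘ = Σ_i NH_i` is a
`G/N`-relation."; §1 (p0003): "a formal linear combination of subgroups `Θ = Σ_i n_i H_i` is a Brauer relation (or
simply a relation) in `G` if `Σ_i n_i Ind_{H_i}^G 1_{H_i} = 0`."

V. Dokchitser, H. Green, A. Konstantinou, A. Morgan, *Parity of ranks of Jacobians of curves*, arXiv 2211.06357 (held
`paper:arxiv-2211.06357`), §1.3 p0004: "**Theorem 1.3** ([Kani–Rosen] Theorem 3 …) For every Brauer relation
`Θ = Σ_i H_i − Σ_j H_j'` for `G`, there is an isogeny `∏_j Jac_{X/H_j'} → ∏_i Jac_{X/H_i}`."  E. Kani, M. Rosen, Math.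
Ann. **284** (1989) 307–327, Theorem 3 (paywalled, acq-09882).

## Dictionary and what is proved

`G` finite acting on `X` by `ρ : G →* End X`; `N ◁ G`; for `H ≤ G`, `NH = N ⊔ H` (Mathlib `Subgroup.normal_mul`:
`↑(N ⊔ H) = N * H`), `N ∩ H = N ⊓ H`; `N_H` with `End.of N_H = Σ_{h ∈ H} ρ h`, `B_H = Im N_H`, `N_G = Σ_g ρ g`;
class functions `f : G → ℤ`, `f(aga⁻¹) = f(g)`.

* §1 (group theory) `card_mul_inv_mem_of_mem_sup` / `card_mul_inv_mem_of_not_mem_sup`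
  (`|{h ∈ H : yh⁻¹ ∈ N}| = |N ∩ H|·[y ∈ NH]`), **`sum_sum_normal_mul_eq_card_inf_smul`**
  (`Σ_{h ∈ H} Σ_{n ∈ N} f(nh) = |N ∩ H| · Σ_{y ∈ NH} f(y)` for every `f : G → M`), `card_inf_mul_card_sup`
  (`|N ∩ H|·|NH| = |N|·|H|`), `sum_normal_mul_conj_eq` (`f̃` is a class function), `sum_sum_normal_mul_eq`
  (`Σ_G f̃ = |N| Σ_G f`), and **`classRelation_sup_of_classRelation`** (DEFLATION of a relation of class functions:
  `c₀ f(1) + c_G Σ_G f + Σ_i c_i Σ_{H_i} f = ⋯` for all class `f` ⟹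
  `c_G|N| Σ_G f + (c₀ Σ_N f + Σ_i c_i|N ∩ H_i| Σ_{NH_i} f) = ⋯` for all class `f`).
* §2 (any field) **`sum_mul_finrank_hom_eq_of_classRelation_sup`**: for every `B`,
  `c₀ rk Hom(B_N, B) + c_G|G| rk Hom(B_G, B) + Σ_i c_i|H_i| rk Hom(B_{NH_i}, B) = d₀ rk Hom(B_N, B) + ⋯`
  (the Hom counts of the original relation with `X ↦ B_N`, `B_{H_i} ↦ B_{NH_i}`), its marks-input form
  `sum_mul_finrank_hom_eq_of_marks_sup`; (perfect field) **`isIsogenous_of_classRelation_sup`**,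
  **`isIsogenous_of_brauerRelation_sup`** (`B_N^{c₀} × B_G^{c_G|G|} × ∏_i B_{NH_i}^{c_i|H_i|} ∼ B_N^{d₀} × ⋯`:
  "`NΘ = Σ_i NH_i` is a `G/N`-relation", whence "an isogeny `∏_j Jac_{X/NH_j'} → ∏_i Jac_{X/NH_i}`" with
  `Jac_{X/N}` in place of `Jac_X`) and **`isIsogenous_of_brauerRelation_sup_div`** (exponents divided by a common `L`).

Scope (stated, not hidden). (1) The `G/N`-variety `B_N` with its `G/N`-action is not constructed: the projected
relation is stated on `X` through `N ⊔ H_i` and `N`.  (2) Restriction of relations (Mackey) is not formalised.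
(3) Hom counts over ANY field; isogenies over a PERFECT field.

## References

* [BartelDokchitser2015] A. Bartel, T. Dokchitser, *Brauer relations in finite groups*, JEMS 17 (2015) 2473–2512,
  arXiv:1103.2047, §1 (definition), §2 (First properties: projection / deflation).
* [KaniRosen1989] E. Kani, M. Rosen, Math. Ann. 284 (1989) 307–327, Thm. 3.
* [DokchitserEtAl2022] V. Dokchitser, H. Green, A. Konstantinou, A. Morgan, arXiv:2211.06357, §1.3 Thm. 1.3.
-/

noncomputable section

universe u

open CategoryTheory CategoryTheory.Limits

namespace Literature.AlgebraicGeometry.Motives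

namespace AbelianVariety

/-! ## §1 The `N`-average of a class function and the fibres of `N × H → NH` -/

section Deflation

variable {G : Type} [Group G] (N H : Subgroup G) [N.Normal]

/-- **The fibres of `N × H → NH` are cosets of `N ∩ H`**: for `y ∈ NH = N ⊔ H`, `|{h ∈ H : yh⁻¹ ∈ N}| = |N ∩ H|`
(if `y = n₀h₀` then `h ↦ h₀h⁻¹` is a bijection onto `N ∩ H`). [cite: BartelDokchitser2015, §2 (Projection)] -/
theorem card_mul_inv_mem_of_mem_sup {y : G} (hy : y ∈ N ⊔ H) :
    Nat.card {h : H // y * (h : G)⁻¹ ∈ N} = Nat.card (N ⊓ H : Subgroup G) := by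
  have hy' : y ∈ ((N ⊔ H : Subgroup G) : Set G) := hy
  rw [Subgroup.normal_mul] at hy'
  obtain ⟨n₀, hn₀, h₀, hh₀, rfl⟩ := Set.mem_mul.1 hy'
  have key : ∀ h : H, n₀ * h₀ * (h : G)⁻¹ ∈ N ↔ h₀ * (h : G)⁻¹ ∈ N := fun h ↦ by
    constructor
    · intro hm
      have e : h₀ * (h : G)⁻¹ = n₀⁻¹ * (n₀ * h₀ * (h : G)⁻¹) := by group
      rw [e]
      exact N.mul_mem (N.inv_mem hn₀) hm
    · intro hm
      rw [mul_assoc]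
      exact N.mul_mem hn₀ hm
  refine Nat.card_congr
    { toFun := fun h ↦ ⟨h₀ * (h.1 : G)⁻¹, Subgroup.mem_inf.2 ⟨(key h.1).1 h.2, H.mul_mem hh₀ (H.inv_mem h.1.2)⟩⟩
      invFun := fun k ↦ ⟨⟨(k.1 : G)⁻¹ * h₀, H.mul_mem (H.inv_mem (Subgroup.mem_inf.1 k.2).2) hh₀⟩, (key _).2 (by
        rw [show h₀ * ((k.1 : G)⁻¹ * h₀)⁻¹ = k.1 by group]
        exact (Subgroup.mem_inf.1 k.2).1)⟩
      left_inv := fun h ↦ Subtype.ext (Subtype.ext (by simp only [mul_inv_rev, inv_inv, inv_mul_cancel_right]))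
      right_inv := fun k ↦ Subtype.ext (by simp only [mul_inv_rev, inv_inv, mul_inv_cancel_left]) }

omit [N.Normal] in
/-- Off `NH` the fibre is empty: for `y ∉ N ⊔ H` no `h ∈ H` has `yh⁻¹ ∈ N`. [cite: BartelDokchitser2015, §2 (Projection)] -/
theorem card_mul_inv_mem_of_not_mem_sup {y : G} (hy : y ∉ N ⊔ H) :
    Nat.card {h : H // y * (h : G)⁻¹ ∈ N} = 0 := by
  rw [Nat.card_eq_zero]
  refine Or.inl ⟨fun h ↦ hy ?_⟩
  rw [show y = y * (h.1 : G)⁻¹ * h.1 by group]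
  exact Subgroup.mul_mem _ (Subgroup.mem_sup_left h.2) (Subgroup.mem_sup_right h.1.2)

/-- **Summing over `N × H` through the product map**: for every `f : G → M`,
`Σ_{h ∈ H} Σ_{n ∈ N} f(nh) = |N ∩ H| · Σ_{y ∈ NH} f(y)` (`NH = N ⊔ H`; each `y ∈ NH` is hit `|N ∩ H|` times).
[cite: BartelDokchitser2015, §2 (Projection)] -/
theorem sum_sum_normal_mul_eq_card_inf_smul [Fintype G] [Fintype N] [Fintype H] [Fintype (N ⊔ H : Subgroup G)]
    {M : Type*} [AddCommMonoid M] (f : G → M) :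
    ∑ h : H, ∑ n : N, f (n * h) = Nat.card (N ⊓ H : Subgroup G) • ∑ y : (N ⊔ H : Subgroup G), f y := by
  classical
  -- the inner sum is the sum of `f` over the coset `N h`
  have h1 : ∀ h : H, ∑ n : N, f (n * h) = ∑ y : G, if y * (h : G)⁻¹ ∈ N then f y else 0 := fun h ↦
    calc ∑ n : N, f (n * h) = ∑ y : {y : G // y * (h : G)⁻¹ ∈ N}, f y :=
          Fintype.sum_equiv
            ⟨fun n ↦ ⟨n * h, by rw [mul_inv_cancel_right]; exact n.2⟩, fun y ↦ ⟨y.1 * (h : G)⁻¹, y.2⟩,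
              fun n ↦ Subtype.ext (mul_inv_cancel_right _ _), fun y ↦ Subtype.ext (inv_mul_cancel_right _ _)⟩
            _ _ fun _ ↦ rfl
      _ = ∑ y ∈ Finset.univ.filter (fun y : G ↦ y * (h : G)⁻¹ ∈ N), f y :=
          (Finset.sum_subtype _ (fun y ↦ by simp) _).symm
      _ = ∑ y : G, if y * (h : G)⁻¹ ∈ N then f y else 0 := Finset.sum_filter _ _
  -- the number of `h` with `y h⁻¹ ∈ N`
  have h2 : ∀ y : G, ∑ h : H, (if y * (h : G)⁻¹ ∈ N then f y else 0) =
      Nat.card {h : H // y * (h : G)⁻¹ ∈ N} • f y := fun y ↦ by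
    rw [← Finset.sum_filter, Finset.sum_const, Nat.card_eq_fintype_card, Fintype.card_subtype]
  calc ∑ h : H, ∑ n : N, f (n * h)
      = ∑ h : H, ∑ y : G, if y * (h : G)⁻¹ ∈ N then f y else 0 := Finset.sum_congr rfl fun h _ ↦ h1 h
    _ = ∑ y : G, ∑ h : H, (if y * (h : G)⁻¹ ∈ N then f y else 0) := Finset.sum_comm
    _ = ∑ y : G, (if y ∈ N ⊔ H then Nat.card (N ⊓ H : Subgroup G) else 0) • f y :=
        Finset.sum_congr rfl fun y _ ↦ by
          rw [h2 y]
          by_cases hy : y ∈ N ⊔ H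
          · rw [card_mul_inv_mem_of_mem_sup N H hy, if_pos hy]
          · rw [card_mul_inv_mem_of_not_mem_sup N H hy, if_neg hy]
    _ = Nat.card (N ⊓ H : Subgroup G) • ∑ y : G, if y ∈ N ⊔ H then f y else 0 := by
        rw [Finset.smul_sum]
        exact Finset.sum_congr rfl fun y _ ↦ by split_ifs <;> simp
    _ = Nat.card (N ⊓ H : Subgroup G) • ∑ y : (N ⊔ H : Subgroup G), f y := by
        rw [← Finset.sum_filter]
        exact congrArg _ (Finset.sum_subtype _ (fun y ↦ by simp) _)

/-- **`|N ∩ H| · |NH| = |N| · |H|`** (the product formula, from the fibre count with `f = 1`).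
[cite: BartelDokchitser2015, §2 (Projection)] -/
theorem card_inf_mul_card_sup [Fintype G] [Fintype N] [Fintype H] [Fintype (N ⊔ H : Subgroup G)] :
    Nat.card (N ⊓ H : Subgroup G) * Fintype.card (N ⊔ H : Subgroup G) = Fintype.card N * Fintype.card H := by
  have h := sum_sum_normal_mul_eq_card_inf_smul N H fun _ ↦ (1 : ℕ)
  simp only [Finset.sum_const, Finset.card_univ, smul_eq_mul, mul_one] at h
  rw [← h, mul_comm]

/-- **The `N`-average of a class function is a class function**: with `f̃(g) = Σ_{n ∈ N} f(ng)` and `N ◁ G`,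
`f̃(aga⁻¹) = f̃(g)` (reindex by `n ↦ a⁻¹na`). [cite: BartelDokchitser2015, §2 (Projection)] -/
theorem sum_normal_mul_conj_eq [Fintype N] {M : Type*} [AddCommMonoid M] (f : G → M)
    (hf : ∀ a g, f (a * g * a⁻¹) = f g) (a g : G) :
    ∑ n : N, f (n * (a * g * a⁻¹)) = ∑ n : N, f (n * g) := by
  refine Fintype.sum_equiv (MulAut.conjNormal a⁻¹).toEquiv _ _ fun n ↦ ?_
  rw [MulEquiv.toEquiv_eq_coe, MulEquiv.coe_toEquiv, MulAut.conjNormal_apply, inv_inv,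
    ← hf a (a⁻¹ * n * a * g)]
  congr 1
  group

omit [N.Normal] in
/-- **`Σ_G f̃ = |N| · Σ_G f`** for the `N`-average `f̃(g) = Σ_{n ∈ N} f(ng)` (each `g ↦ ng` is a bijection of `G`).
[cite: BartelDokchitser2015, §2 (Projection)] -/
theorem sum_sum_normal_mul_eq [Fintype G] [Fintype N] {M : Type*} [AddCommMonoid M] (f : G → M) :
    ∑ g : G, ∑ n : N, f (n * g) = Fintype.card N • ∑ g : G, f g := by
  rw [Finset.sum_comm]
  have h : ∀ n : N, ∑ g : G, f (n * g) = ∑ g : G, f g := fun n ↦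
    Fintype.sum_equiv (Equiv.mulLeft (n : G)) _ _ fun _ ↦ rfl
  simp only [h, Finset.sum_const, Finset.card_univ]

/-- **DEFLATION of a relation of class functions** ("If `N ◁ G`, then `NΘ = Σ_i NH_i` is a `G/N`-relation"): if
`c₀ f(1) + c_G Σ_G f + Σ_i c_i Σ_{H_i} f = d₀ f(1) + d_G Σ_G f + Σ_j d_j Σ_{H'_j} f` for every class function `f` on
`G`, then, applying it to the `N`-average `f̃`,
**`c_G|N| Σ_G f + (c₀ Σ_N f + Σ_i c_i|N ∩ H_i| Σ_{NH_i} f) = d_G|N| Σ_G f + (d₀ Σ_N f + Σ_j d_j|N ∩ H'_j| Σ_{NH'_j} f)`**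
for every class function `f` — the relation for the families `(N; NH_i)`, `(N; NH'_j)` (`{1} ↦ N`, `H ↦ NH`).
[cite: BartelDokchitser2015, §2 (Projection)] -/
theorem classRelation_sup_of_classRelation [Fintype G] [Fintype N] {ι ι' : Type} [Fintype ι] [Fintype ι']
    (F : ι → Subgroup G) (F' : ι' → Subgroup G) [∀ i, Fintype (F i)] [∀ j, Fintype (F' j)]
    [∀ i, Fintype (N ⊔ F i : Subgroup G)] [∀ j, Fintype (N ⊔ F' j : Subgroup G)]
    (c₀ cG : ℕ) (c : ι → ℕ) (d₀ dG : ℕ) (d : ι' → ℕ)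
    (hrel : ∀ f : G → ℤ, (∀ a g, f (a * g * a⁻¹) = f g) →
      (c₀ : ℤ) * f 1 + cG * ∑ g, f g + ∑ i, (c i : ℤ) * ∑ h : F i, f h =
        d₀ * f 1 + dG * ∑ g, f g + ∑ j, (d j : ℤ) * ∑ h : F' j, f h)
    (f : G → ℤ) (hf : ∀ a g, f (a * g * a⁻¹) = f g) :
    ((cG * Fintype.card N : ℕ) : ℤ) * ∑ g, f g +
        ((c₀ : ℤ) * ∑ n : N, f n + ∑ i, ((c i * Nat.card (N ⊓ F i : Subgroup G) : ℕ) : ℤ) *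
          ∑ y : (N ⊔ F i : Subgroup G), f y) =
      ((dG * Fintype.card N : ℕ) : ℤ) * ∑ g, f g +
        ((d₀ : ℤ) * ∑ n : N, f n + ∑ j, ((d j * Nat.card (N ⊓ F' j : Subgroup G) : ℕ) : ℤ) *
          ∑ y : (N ⊔ F' j : Subgroup G), f y) := by
  have key := hrel (fun g ↦ ∑ n : N, f (n * g)) (sum_normal_mul_conj_eq N f hf)
  have e1 : (∑ n : N, f (n * 1)) = ∑ n : N, f n := Finset.sum_congr rfl fun n _ ↦ by rw [mul_one]
  have eF : ∀ i, ∑ h : F i, ∑ n : N, f (n * h) =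
      Nat.card (N ⊓ F i : Subgroup G) • ∑ y : (N ⊔ F i : Subgroup G), f y := fun i ↦
    sum_sum_normal_mul_eq_card_inf_smul N (F i) f
  have eF' : ∀ j, ∑ h : F' j, ∑ n : N, f (n * h) =
      Nat.card (N ⊓ F' j : Subgroup G) • ∑ y : (N ⊔ F' j : Subgroup G), f y := fun j ↦
    sum_sum_normal_mul_eq_card_inf_smul N (F' j) f
  simp only [e1, sum_sum_normal_mul_eq N f, eF, eF', nsmul_eq_mul] at key
  push_cast
  simp only [mul_assoc] at key ⊢
  linear_combination key

end Deflation

/-! ## §2 The projected Kani–Rosen relations: `B_N^{c₀} × B_G^{c_G|G|} × ∏_i B_{NH_i}^{c_i|H_i|} ∼ ⋯` -/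

section DeflationAV

variable {K : Type u} [Field K] {X : AbelianVariety K} {G : Type} [Group G] [Fintype G]
  (ρ : G →* End X) (N : Subgroup G) [N.Normal] [Fintype N] {ι ι' : Type} [Fintype ι] [Fintype ι']
  (F : ι → Subgroup G) (F' : ι' → Subgroup G) [∀ i, Fintype (F i)] [∀ j, Fintype (F' j)]
  [∀ i, Fintype (N ⊔ F i : Subgroup G)] [∀ j, Fintype (N ⊔ F' j : Subgroup G)]
  {M : ι → (X ⟶ X)} {M' : ι' → (X ⟶ X)} {NN NG : X ⟶ X} (c₀ cG : ℕ) (c : ι → ℕ) (d₀ dG : ℕ) (d : ι' → ℕ)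

/-- **The Hom counts of a projected relation** (any field).  If
`c₀ f(1) + c_G Σ_G f + Σ_i c_i Σ_{H_i} f = d₀ f(1) + d_G Σ_G f + Σ_j d_j Σ_{H'_j} f` for every class function `f` on
`G` (e.g. a Brauer relation of `G`), then for every normal subgroup `N`, every `G`-action on `X` and every `B`:
**`c₀ rk Hom(B_N, B) + c_G|G| rk Hom(B_G, B) + Σ_i c_i|H_i| rk Hom(B_{NH_i}, B) =
d₀ rk Hom(B_N, B) + d_G|G| rk Hom(B_G, B) + Σ_j d_j|H'_j| rk Hom(B_{NH'_j}, B)`** — the Hom counts of the relation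
itself (`sum_mul_finrank_hom_image_eq_of_classRelation`) with `X` replaced by `B_N` and `B_{H}` by `B_{NH}`
(`classRelation_sup_of_classRelation`, then `|N ∩ H||NH| = |N||H|` and division by `|N|`).
[cite: BartelDokchitser2015, §2 (Projection)] [cite: KaniRosen1989, Thm. 3] [cite: DokchitserEtAl2022, §1.3 Thm. 1.3] -/
theorem sum_mul_finrank_hom_eq_of_classRelation_sup
    (hrel : ∀ f : G → ℤ, (∀ a g, f (a * g * a⁻¹) = f g) →
      (c₀ : ℤ) * f 1 + cG * ∑ g, f g + ∑ i, (c i : ℤ) * ∑ h : F i, f h =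
        d₀ * f 1 + dG * ∑ g, f g + ∑ j, (d j : ℤ) * ∑ h : F' j, f h)
    (hNN : End.of NN = ∑ h : N, ρ h) (hM : ∀ i, End.of (M i) = ∑ h : (N ⊔ F i : Subgroup G), ρ h)
    (hM' : ∀ j, End.of (M' j) = ∑ h : (N ⊔ F' j : Subgroup G), ρ h) (hNG : End.of NG = ∑ g, ρ g)
    (B : AbelianVariety K) :
    c₀ * Module.finrank ℤ (image NN ⟶ B) + cG * Fintype.card G * Module.finrank ℤ (image NG ⟶ B) +
        ∑ i, c i * Fintype.card (F i) * Module.finrank ℤ (image (M i) ⟶ B) =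
      d₀ * Module.finrank ℤ (image NN ⟶ B) + dG * Fintype.card G * Module.finrank ℤ (image NG ⟶ B) +
        ∑ j, d j * Fintype.card (F' j) * Module.finrank ℤ (image (M' j) ⟶ B) := by
  classical
  -- the projected families, indexed by `Option ι`, `Option ι'`: `none ↦ N`
  let H : Option ι → Subgroup G := fun o ↦ o.elim N fun i ↦ N ⊔ F i
  let H' : Option ι' → Subgroup G := fun o ↦ o.elim N fun j ↦ N ⊔ F' j
  let instH : ∀ o, Fintype (H o) := fun o ↦
    match o with
    | none => ‹Fintype N›
    | some i => ‹∀ i, Fintype (N ⊔ F i : Subgroup G)› i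
  let instH' : ∀ o, Fintype (H' o) := fun o ↦
    match o with
    | none => ‹Fintype N›
    | some j => ‹∀ j, Fintype (N ⊔ F' j : Subgroup G)› j
  let Mf : Option ι → (X ⟶ X) := fun o ↦ o.elim NN M
  let Mf' : Option ι' → (X ⟶ X) := fun o ↦ o.elim NN M'
  let cc : Option ι → ℕ := fun o ↦ o.elim c₀ fun i ↦ c i * Nat.card (N ⊓ F i : Subgroup G)
  let dd : Option ι' → ℕ := fun o ↦ o.elim d₀ fun j ↦ d j * Nat.card (N ⊓ F' j : Subgroup G)
  have hMf : ∀ o, End.of (Mf o) = ∑ h : H o, ρ h := by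
    rintro (_ | i)
    · exact hNN
    · exact hM i
  have hMf' : ∀ o, End.of (Mf' o) = ∑ h : H' o, ρ h := by
    rintro (_ | j)
    · exact hNN
    · exact hM' j
  -- the projected relation of class functions, in the format of the engine
  have hrel' : ∀ f : G → ℤ, (∀ a g, f (a * g * a⁻¹) = f g) →
      ((0 : ℕ) : ℤ) * f 1 + ((cG * Fintype.card N : ℕ) : ℤ) * ∑ g, f g +
          ∑ o : Option ι, (cc o : ℤ) * @Finset.sum _ _ _ (@Finset.univ _ (instH o)) (fun h ↦ f h) =
        ((0 : ℕ) : ℤ) * f 1 + ((dG * Fintype.card N : ℕ) : ℤ) * ∑ g, f g +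
          ∑ o : Option ι', (dd o : ℤ) * @Finset.sum _ _ _ (@Finset.univ _ (instH' o)) (fun h ↦ f h) := by
    intro f hf
    have h := classRelation_sup_of_classRelation N F F' c₀ cG c d₀ dG d hrel f hf
    rw [Fintype.sum_option, Fintype.sum_option]
    simp only [Nat.cast_zero, zero_mul, zero_add]
    exact h
  have key := @sum_mul_finrank_hom_image_eq_of_classRelation K _ X G _ _ ρ (Option ι) (Option ι') _ _ H H' instH
    instH' Mf Mf' NG 0 (cG * Fintype.card N) cc 0 (dG * Fintype.card N) dd hrel' hMf hMf' hNG B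
  rw [Fintype.sum_option, Fintype.sum_option] at key
  -- unfold the `Option` families (definitionally)
  have key' : 0 * Module.finrank ℤ (X ⟶ B) +
      cG * Fintype.card N * Fintype.card G * Module.finrank ℤ (image NG ⟶ B) +
      (c₀ * Fintype.card N * Module.finrank ℤ (image NN ⟶ B) +
        ∑ i, c i * Nat.card (N ⊓ F i : Subgroup G) * Fintype.card (N ⊔ F i : Subgroup G) *
          Module.finrank ℤ (image (M i) ⟶ B)) =
      0 * Module.finrank ℤ (X ⟶ B) + dG * Fintype.card N * Fintype.card G * Module.finrank ℤ (image NG ⟶ B) +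
      (d₀ * Fintype.card N * Module.finrank ℤ (image NN ⟶ B) +
        ∑ j, d j * Nat.card (N ⊓ F' j : Subgroup G) * Fintype.card (N ⊔ F' j : Subgroup G) *
          Module.finrank ℤ (image (M' j) ⟶ B)) := key
  -- `|N ∩ H| |NH| = |N| |H|`, then divide by `|N|`
  have e₁ : ∀ i, c i * Nat.card (N ⊓ F i : Subgroup G) * Fintype.card (N ⊔ F i : Subgroup G) *
      Module.finrank ℤ (image (M i) ⟶ B) =
      Fintype.card N * (c i * Fintype.card (F i) * Module.finrank ℤ (image (M i) ⟶ B)) := fun i ↦ by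
    rw [mul_assoc (c i), card_inf_mul_card_sup N (F i)]
    ring
  have e₂ : ∀ j, d j * Nat.card (N ⊓ F' j : Subgroup G) * Fintype.card (N ⊔ F' j : Subgroup G) *
      Module.finrank ℤ (image (M' j) ⟶ B) =
      Fintype.card N * (d j * Fintype.card (F' j) * Module.finrank ℤ (image (M' j) ⟶ B)) := fun j ↦ by
    rw [mul_assoc (d j), card_inf_mul_card_sup N (F' j)]
    ring
  simp only [e₁, e₂, ← Finset.mul_sum, zero_mul, zero_add] at key'
  refine Nat.eq_of_mul_eq_mul_left (Fintype.card_pos (α := N)) ?_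
  simp only [mul_add]
  linear_combination key'

/-- **The Hom counts of a projected Brauer relation given by marks** (any field): if for all `g ∈ G`
`c₀|G|[g = 1] + c_G|G| + Σ_i c_i m_{H_i}(g) = d₀|G|[g = 1] + d_G|G| + Σ_j d_j m_{H'_j}(g)`
(`m_H(g) = |{x : x⁻¹gx ∈ H}|`), then for every `N ◁ G` and `B` the Hom counts of
`sum_mul_finrank_hom_eq_of_classRelation_sup` hold. [cite: BartelDokchitser2015, §2 (Projection)] [cite: KaniRosen1989, Thm. 3] -/
theorem sum_mul_finrank_hom_eq_of_marks_sup [DecidableEq G]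
    (hmarks : ∀ g : G, c₀ * (if g = 1 then Fintype.card G else 0) + cG * Fintype.card G +
        ∑ i, c i * Nat.card {x : G // x⁻¹ * g * x ∈ F i} =
      d₀ * (if g = 1 then Fintype.card G else 0) + dG * Fintype.card G +
        ∑ j, d j * Nat.card {x : G // x⁻¹ * g * x ∈ F' j})
    (hNN : End.of NN = ∑ h : N, ρ h) (hM : ∀ i, End.of (M i) = ∑ h : (N ⊔ F i : Subgroup G), ρ h)
    (hM' : ∀ j, End.of (M' j) = ∑ h : (N ⊔ F' j : Subgroup G), ρ h) (hNG : End.of NG = ∑ g, ρ g)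
    (B : AbelianVariety K) :
    c₀ * Module.finrank ℤ (image NN ⟶ B) + cG * Fintype.card G * Module.finrank ℤ (image NG ⟶ B) +
        ∑ i, c i * Fintype.card (F i) * Module.finrank ℤ (image (M i) ⟶ B) =
      d₀ * Module.finrank ℤ (image NN ⟶ B) + dG * Fintype.card G * Module.finrank ℤ (image NG ⟶ B) +
        ∑ j, d j * Fintype.card (F' j) * Module.finrank ℤ (image (M' j) ⟶ B) :=
  sum_mul_finrank_hom_eq_of_classRelation_sup ρ N F F' c₀ cG c d₀ dG d
    (classRelation_of_marks F F' c₀ cG c d₀ dG d hmarks) hNN hM hM' hNG B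

variable [DecidableEq ι] [DecidableEq ι'] [PerfectField K]

/-- **Kani–Rosen's Theorem 3 for a PROJECTED relation** (perfect field): under the class-function relation of
`sum_mul_finrank_hom_eq_of_classRelation_sup`,
**`B_N^{c₀} × B_G^{c_G|G|} × ∏_i B_{NH_i}^{c_i|H_i|} ∼ B_N^{d₀} × B_G^{d_G|G|} × ∏_j B_{NH'_j}^{d_j|H'_j|}`** — the
isogeny relation of `Θ` (`isIsogenous_of_classRelation`) with `X ↦ B_N`, `B_H ↦ B_{NH}`: "`NΘ = Σ_i NH_i` is a
`G/N`-relation". [cite: BartelDokchitser2015, §2 (Projection)] [cite: KaniRosen1989, Thm. 3] [cite: DokchitserEtAl2022, §1.3 Thm. 1.3] -/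
theorem isIsogenous_of_classRelation_sup
    (hrel : ∀ f : G → ℤ, (∀ a g, f (a * g * a⁻¹) = f g) →
      (c₀ : ℤ) * f 1 + cG * ∑ g, f g + ∑ i, (c i : ℤ) * ∑ h : F i, f h =
        d₀ * f 1 + dG * ∑ g, f g + ∑ j, (d j : ℤ) * ∑ h : F' j, f h)
    (hNN : End.of NN = ∑ h : N, ρ h) (hM : ∀ i, End.of (M i) = ∑ h : (N ⊔ F i : Subgroup G), ρ h)
    (hM' : ∀ j, End.of (M' j) = ∑ h : (N ⊔ F' j : Subgroup G), ρ h) (hNG : End.of NG = ∑ g, ρ g) :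
    IsIsogenous
      ((⨁ fun _ : Fin c₀ ↦ image NN) ⊞ (⨁ fun _ : Fin (cG * Fintype.card G) ↦ image NG) ⊞
        ⨁ fun i ↦ ⨁ fun _ : Fin (c i * Fintype.card (F i)) ↦ image (M i))
      ((⨁ fun _ : Fin d₀ ↦ image NN) ⊞ (⨁ fun _ : Fin (dG * Fintype.card G) ↦ image NG) ⊞
        ⨁ fun j ↦ ⨁ fun _ : Fin (d j * Fintype.card (F' j)) ↦ image (M' j)) := by
  refine isIsogenous_iff_forall_finrank_hom_eq'.2 fun B ↦ ?_
  simp only [finrank_hom_biprod, finrank_hom_biproduct, Finset.sum_const, Finset.card_univ, Fintype.card_fin,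
    smul_eq_mul]
  have key := sum_mul_finrank_hom_eq_of_classRelation_sup ρ N F F' c₀ cG c d₀ dG d hrel hNN hM hM' hNG B
  simp only [mul_assoc, add_assoc] at key ⊢
  exact key

/-- **Kani–Rosen's Theorem 3 for a PROJECTED Brauer relation given by marks** (perfect field): if for all `g ∈ G`
`c₀|G|[g = 1] + c_G|G| + Σ_i c_i m_{H_i}(g) = d₀|G|[g = 1] + d_G|G| + Σ_j d_j m_{H'_j}(g)`, then for every `N ◁ G`:
**`B_N^{c₀} × B_G^{c_G|G|} × ∏_i B_{NH_i}^{c_i|H_i|} ∼ B_N^{d₀} × B_G^{d_G|G|} × ∏_j B_{NH'_j}^{d_j|H'_j|}`**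
("If `N ◁ G`, then `NΘ = Σ_i NH_i` is a `G/N`-relation", whence "an isogeny `∏_j Jac_{X/NH_j'} → ∏_i Jac_{X/NH_i}`",
`Jac_X` replaced by `Jac_{X/N}`). [cite: BartelDokchitser2015, §2 (Projection)] [cite: KaniRosen1989, Thm. 3]
[cite: DokchitserEtAl2022, §1.3 Thm. 1.3] -/
theorem isIsogenous_of_brauerRelation_sup [DecidableEq G]
    (hmarks : ∀ g : G, c₀ * (if g = 1 then Fintype.card G else 0) + cG * Fintype.card G +
        ∑ i, c i * Nat.card {x : G // x⁻¹ * g * x ∈ F i} =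
      d₀ * (if g = 1 then Fintype.card G else 0) + dG * Fintype.card G +
        ∑ j, d j * Nat.card {x : G // x⁻¹ * g * x ∈ F' j})
    (hNN : End.of NN = ∑ h : N, ρ h) (hM : ∀ i, End.of (M i) = ∑ h : (N ⊔ F i : Subgroup G), ρ h)
    (hM' : ∀ j, End.of (M' j) = ∑ h : (N ⊔ F' j : Subgroup G), ρ h) (hNG : End.of NG = ∑ g, ρ g) :
    IsIsogenous
      ((⨁ fun _ : Fin c₀ ↦ image NN) ⊞ (⨁ fun _ : Fin (cG * Fintype.card G) ↦ image NG) ⊞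
        ⨁ fun i ↦ ⨁ fun _ : Fin (c i * Fintype.card (F i)) ↦ image (M i))
      ((⨁ fun _ : Fin d₀ ↦ image NN) ⊞ (⨁ fun _ : Fin (dG * Fintype.card G) ↦ image NG) ⊞
        ⨁ fun j ↦ ⨁ fun _ : Fin (d j * Fintype.card (F' j)) ↦ image (M' j)) :=
  isIsogenous_of_classRelation_sup ρ N F F' c₀ cG c d₀ dG d (classRelation_of_marks F F' c₀ cG c d₀ dG d hmarks)
    hNN hM hM' hNG

/-- **The projected relation with exponents divided by a common `L ≠ 0`** (`L e₀ = c₀`, `L e_G = c_G|G|`,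
`L e_i = c_i|H_i|`, and likewise on the right): `B_N^{e₀} × B_G^{e_G} × ∏_i B_{NH_i}^{e_i} ∼ B_N^{e₀'} × B_G^{e_G'} ×
∏_j B_{NH'_j}^{e_j'}` — for a Brauer relation `Σ_i H_i − Σ_j H'_j` proper all `e = 1`:
"`∏_j Jac_{X/NH_j'} → ∏_i Jac_{X/NH_i}`". [cite: BartelDokchitser2015, §2 (Projection)] [cite: KaniRosen1989, Thm. 3] -/
theorem isIsogenous_of_brauerRelation_sup_div [DecidableEq G]
    (hmarks : ∀ g : G, c₀ * (if g = 1 then Fintype.card G else 0) + cG * Fintype.card G +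
        ∑ i, c i * Nat.card {x : G // x⁻¹ * g * x ∈ F i} =
      d₀ * (if g = 1 then Fintype.card G else 0) + dG * Fintype.card G +
        ∑ j, d j * Nat.card {x : G // x⁻¹ * g * x ∈ F' j})
    (hNN : End.of NN = ∑ h : N, ρ h) (hM : ∀ i, End.of (M i) = ∑ h : (N ⊔ F i : Subgroup G), ρ h)
    (hM' : ∀ j, End.of (M' j) = ∑ h : (N ⊔ F' j : Subgroup G), ρ h) (hNG : End.of NG = ∑ g, ρ g)
    {L e₀ eG e₀' eG' : ℕ} {e : ι → ℕ} {e' : ι' → ℕ} (hL : L ≠ 0) (he₀ : L * e₀ = c₀)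
    (heG : L * eG = cG * Fintype.card G) (he : ∀ i, L * e i = c i * Fintype.card (F i)) (he₀' : L * e₀' = d₀)
    (heG' : L * eG' = dG * Fintype.card G) (he' : ∀ j, L * e' j = d j * Fintype.card (F' j)) :
    IsIsogenous
      ((⨁ fun _ : Fin e₀ ↦ image NN) ⊞ (⨁ fun _ : Fin eG ↦ image NG) ⊞ ⨁ fun i ↦ ⨁ fun _ : Fin (e i) ↦ image (M i))
      ((⨁ fun _ : Fin e₀' ↦ image NN) ⊞ (⨁ fun _ : Fin eG' ↦ image NG) ⊞
        ⨁ fun j ↦ ⨁ fun _ : Fin (e' j) ↦ image (M' j)) := by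
  refine isIsogenous_iff_forall_finrank_hom_eq'.2 fun B ↦ ?_
  simp only [finrank_hom_biprod, finrank_hom_biproduct, Finset.sum_const, Finset.card_univ, Fintype.card_fin,
    smul_eq_mul]
  have key := sum_mul_finrank_hom_eq_of_classRelation_sup ρ N F F' c₀ cG c d₀ dG d
    (classRelation_of_marks F F' c₀ cG c d₀ dG d hmarks) hNN hM hM' hNG B
  have hl : ∀ i, c i * Fintype.card (F i) * Module.finrank ℤ (image (M i) ⟶ B) =
      L * (e i * Module.finrank ℤ (image (M i) ⟶ B)) := fun i ↦ by rw [← mul_assoc, he i]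
  have hr : ∀ j, d j * Fintype.card (F' j) * Module.finrank ℤ (image (M' j) ⟶ B) =
      L * (e' j * Module.finrank ℤ (image (M' j) ⟶ B)) := fun j ↦ by rw [← mul_assoc, he' j]
  simp only [hl, hr, ← he₀, ← heG, ← he₀', ← heG', ← Finset.mul_sum] at key
  refine Nat.eq_of_mul_eq_mul_left (Nat.pos_of_ne_zero hL) ?_
  simp only [mul_add, ← mul_assoc]
  simpa only [← mul_assoc, add_assoc] using key

end DeflationAV

end AbelianVariety

end Literature.AlgebraicGeometry.Motives
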